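import Summits.AtomisticToContinuum.BoseEinsteinCondensation.Theorems.BECInsertionCorrectorStaticResponseBoundUvComposition
import HarnessLib

/-!
# The few-body half of the static response bound, III: the crux BY NAME from the few-body half, the few-body
# window, the truncation limit and the many-body half (line `stable-fraction-square-completion`, seat c2 layer;
# item stmt-AtomisticToContinuum-12057 — this file supports, does not close, the item)

Registered composition `staticResponseBound_of_fewBody` of the seat-c2 skeleton
(`Cruxes/StaticResponseBound/Lines/stable-fraction-square-completion-c2.lean`):

  `StaticResponseBound ⟸ FewBodyBounded ∧ FewBodyWindow ∧ TruncationLimit ∧ LargeNHalf`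

(texts inlined as hypotheses, in this order), together with the truncation step `fewBody_of_truncation`
(`FewBodyBounded` for bounded profiles + `TruncationLimit` ⇒ the few-body inequality for every admissible `v`, hard
cores included) and the calibration `StaticResponseBound → LargeNHalf` (so that, given the provable few-body layer,
`StaticResponseBound ⟺ LargeNHalf`).  `FewBodyBounded` is the lead's stub (parts I–II of this series),
`FewBodyWindow` a registered provable stub, `TruncationLimit` seat c1's S2 (⟸ `MaxFormBound`, p77117), `LargeNHalf` the
crux restricted to `N⁸ρa³ > c` — the thermodynamic content.  Pure bookkeeping: `N = 0` by `ineq_N_zero`; for `N ≥ 1`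
split at `N⁸ρa³ = c(v)`; below, the window gives the few-body regime `N·E₀·L² ≤ 4π²/5` and the ultraviolet branch
`max(ρa,|p|²) = |p|²`; above, `LargeNHalf`; `ρ₀ = min`, `C = max(C_large, 10)`.
-/

noncomputable section

namespace Summit.AtomisticToContinuum.BoseEinsteinCondensation.Cruxes.StaticResponseBound.FewBody

open MeasureTheory Filter
open scoped ENNReal NNReal BigOperators Topology
open Literature.MathematicalPhysics.QuantumManyBody.BoseGas
open Summit.AtomisticToContinuum.BoseEinsteinCondensation.Theses
open Summit.AtomisticToContinuum.BoseEinsteinCondensation.Theses.BECInsertionCorrector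
open Summit.AtomisticToContinuum.BoseEinsteinCondensation.Theorems.StaticResponseBound.Negative
open Summit.AtomisticToContinuum.BoseEinsteinCondensation.Cruxes.StaticResponseBound.UvThomsonForceWave

/-- A truncation `min(v, n)` is admissible (same range) and bounded by `n < ⊤`. [folklore] -/
theorem truncPotential_admissible {v : ℝ → ℝ≥0∞} (hv : IsRepulsiveFiniteRange v) (n : ℕ) :
    IsRepulsiveFiniteRange (truncPotential v n) ∧ ∃ M : ℝ≥0∞, M ≠ ⊤ ∧ ∀ r, truncPotential v n r ≤ M := by
  -- adapted from Theorems/BECThomsonPrincipleDensityResponseDefs.lean and …KineticBranchOfUv.lean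
  refine ⟨⟨measurable_truncPotential hv.1 n, ?_⟩, ⟨n, ENNReal.natCast_ne_top n, fun r => truncPotential_le_nat v n r⟩⟩
  obtain ⟨R₀, hR₀⟩ := hv.2
  refine ⟨R₀, fun r hr => ?_⟩
  unfold truncPotential
  rw [hR₀ r hr]
  exact min_eq_left bot_le

/-- **The few-body half of the crux for every admissible `v`** from `FewBodyBounded` (bounded profiles, first
hypothesis) and `TruncationLimit` (second hypothesis; hard cores: `E₀(min(v,n)) ↑ E₀(v)`) by monotonicity of the energy
in the profile: in the few-body regime `N·E₀(v,N,L)·L² ≤ 4π²/5` the crux's inequality holds with deficit `10t²N/|p|²`.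
[folklore] -/
theorem fewBody_of_truncation
    (hFB : ∀ w : ℝ → ℝ≥0∞, IsRepulsiveFiniteRange w → (∃ M : ℝ≥0∞, M ≠ ⊤ ∧ ∀ r, w r ≤ M) →
        ∀ (N : ℕ) (L : ℝ), 0 < L →
          (N : ℝ) * (periodicGroundStateEnergy w N L).toReal * L ^ 2 ≤ 4 * Real.pi ^ 2 / 5 →
          ∀ (k : Fin 3 → ℤ), k ≠ 0 → ∀ (t : ℝ) (Ψ : PeriodicTrialState N L), periodicEnergy w Ψ ≠ ⊤ →
            (periodicGroundStateEnergy w N L).toReal - 10 * t ^ 2 * N / psq L k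
              ≤ (periodicEnergy w Ψ).toReal + t * cosMean L k Ψ)
    (hT : ∀ v : ℝ → ℝ≥0∞, IsRepulsiveFiniteRange v → ∀ (N : ℕ) (L : ℝ), 0 < L →
        periodicGroundStateEnergy v N L ≠ ⊤ →
        ∀ ε : ℝ, 0 < ε → ∃ n₁ : ℕ, ∀ n : ℕ, n₁ ≤ n →
          (periodicGroundStateEnergy v N L).toReal ≤
            (periodicGroundStateEnergy (truncPotential v n) N L).toReal + ε)
    {v : ℝ → ℝ≥0∞} (hv : IsRepulsiveFiniteRange v) {N : ℕ} {L : ℝ} (hL : 0 < L)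
    (hE : (N : ℝ) * (periodicGroundStateEnergy v N L).toReal * L ^ 2 ≤ 4 * Real.pi ^ 2 / 5)
    {k : Fin 3 → ℤ} (hk : k ≠ 0) (t : ℝ) (Ψ : PeriodicTrialState N L) (hΨ : periodicEnergy v Ψ ≠ ⊤) :
    (periodicGroundStateEnergy v N L).toReal - 10 * t ^ 2 * N / psq L k
      ≤ (periodicEnergy v Ψ).toReal + t * cosMean L k Ψ := by
  have hE0fin : periodicGroundStateEnergy v N L ≠ ⊤ :=
    ne_top_of_le_ne_top hΨ (periodicGroundStateEnergy_le v Ψ)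
  -- the inequality for every truncation
  have key : ∀ n : ℕ, (periodicGroundStateEnergy (truncPotential v n) N L).toReal - 10 * t ^ 2 * N / psq L k
      ≤ (periodicEnergy v Ψ).toReal + t * cosMean L k Ψ := by
    intro n
    obtain ⟨hwn, hbdd⟩ := truncPotential_admissible hv n
    have hΨn : periodicEnergy (truncPotential v n) Ψ ≠ ⊤ :=
      ne_top_of_le_ne_top hΨ (periodicEnergy_truncPotential_le' v n Ψ)
    have hEn_le : (periodicGroundStateEnergy (truncPotential v n) N L).toReal ≤
        (periodicGroundStateEnergy v N L).toReal :=
      ENNReal.toReal_mono hE0fin (periodicGroundStateEnergy_truncPotential_le' v n N L)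
    have hEn : (N : ℝ) * (periodicGroundStateEnergy (truncPotential v n) N L).toReal * L ^ 2 ≤
        4 * Real.pi ^ 2 / 5 := by
      refine le_trans ?_ hE
      have hN : (0 : ℝ) ≤ N := Nat.cast_nonneg N
      have hL2 : (0 : ℝ) ≤ L ^ 2 := sq_nonneg L
      exact mul_le_mul_of_nonneg_right (mul_le_mul_of_nonneg_left hEn_le hN) hL2
    have h := hFB (truncPotential v n) hwn hbdd N L hL hEn k hk t Ψ hΨn
    have hmono : (periodicEnergy (truncPotential v n) Ψ).toReal ≤ (periodicEnergy v Ψ).toReal :=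
      ENNReal.toReal_mono hΨ (periodicEnergy_truncPotential_le' v n Ψ)
    linarith
  -- pass to the limit `n → ∞`
  refine le_of_forall_pos_le_add fun ε hε => ?_
  obtain ⟨n₁, hn₁⟩ := hT v hv N L hL hE0fin ε hε
  have h1 := hn₁ n₁ le_rfl
  have h2 := key n₁
  linarith

/-- **Composition (binder form `staticResponseBound_of_fewBody'`): the crux `StaticResponseBound` BY NAME from the
few-body half (`FewBodyBounded`), the few-body window (`FewBodyWindow`), the truncation limit (`TruncationLimit`)
and the many-body half (`LargeNHalf`)** (texts inlined, in this order).  `N = 0` by `ineq_N_zero`; for `N ≥ 1` split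
at `N⁸ρa³ = c(v)`: below, the window gives the few-body regime and the ultraviolet branch (`max(ρa,|p|²) = |p|²`) and
`fewBody_of_truncation` the inequality with `C = 10`; above, `LargeNHalf`; `ρ₀ = min`, `C = max`. [folklore] -/
theorem staticResponseBound_of_fewBody'
    (hFB : ∀ w : ℝ → ℝ≥0∞, IsRepulsiveFiniteRange w → (∃ M : ℝ≥0∞, M ≠ ⊤ ∧ ∀ r, w r ≤ M) →
        ∀ (N : ℕ) (L : ℝ), 0 < L →
          (N : ℝ) * (periodicGroundStateEnergy w N L).toReal * L ^ 2 ≤ 4 * Real.pi ^ 2 / 5 →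
          ∀ (k : Fin 3 → ℤ), k ≠ 0 → ∀ (t : ℝ) (Ψ : PeriodicTrialState N L), periodicEnergy w Ψ ≠ ⊤ →
            (periodicGroundStateEnergy w N L).toReal - 10 * t ^ 2 * N / psq L k
              ≤ (periodicEnergy w Ψ).toReal + t * cosMean L k Ψ)
    (hW : ∀ v : ℝ → ℝ≥0∞, IsRepulsiveFiniteRange v →
        ∃ ρ₀ : ℝ, 0 < ρ₀ ∧ ∃ c : ℝ, 0 < c ∧
          ∀ ρ : ℝ, 0 < ρ → ρ < ρ₀ → ∀ N : ℕ, 1 ≤ N →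
            (N : ℝ) ^ 8 * (ρ * (scatteringLength v).toReal ^ 3) ≤ c →
            (N : ℝ) * (periodicGroundStateEnergy v N (sideLength ρ N)).toReal * sideLength ρ N ^ 2
                ≤ 4 * Real.pi ^ 2 / 5 ∧
            ∀ k : Fin 3 → ℤ, k ≠ 0 → ρ * (scatteringLength v).toReal ≤ psq (sideLength ρ N) k)
    (hT : ∀ v : ℝ → ℝ≥0∞, IsRepulsiveFiniteRange v → ∀ (N : ℕ) (L : ℝ), 0 < L →
        periodicGroundStateEnergy v N L ≠ ⊤ →
        ∀ ε : ℝ, 0 < ε → ∃ n₁ : ℕ, ∀ n : ℕ, n₁ ≤ n →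
          (periodicGroundStateEnergy v N L).toReal ≤
            (periodicGroundStateEnergy (truncPotential v n) N L).toReal + ε)
    (hG : ∀ v : ℝ → ℝ≥0∞, IsRepulsiveFiniteRange v → ∀ c : ℝ, 0 < c →
        ∃ ρ₀ : ℝ, 0 < ρ₀ ∧ ∃ C : ℝ, 0 < C ∧
          ∀ ρ : ℝ, 0 < ρ → ρ < ρ₀ → ∀ N : ℕ,
            c < (N : ℝ) ^ 8 * (ρ * (scatteringLength v).toReal ^ 3) →
            ∀ k : Fin 3 → ℤ, k ≠ 0 → ∀ t : ℝ, ∀ Ψ : PeriodicTrialState N (sideLength ρ N),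
              periodicEnergy v Ψ ≠ ⊤ → Ineq v C ρ N k t Ψ) :
    StaticResponseBound := by
  intro v hv
  obtain ⟨ρ₁, hρ₁, c, hc, hwin⟩ := hW v hv
  obtain ⟨ρ₂, hρ₂, C₂, hC₂, hlarge⟩ := hG v hv c hc
  refine ⟨min ρ₁ ρ₂, lt_min hρ₁ hρ₂, max C₂ 10, lt_of_lt_of_le hC₂ (le_max_left _ _), ?_⟩
  intro ρ hρ hρlt N k hk t Ψ hΨ
  change Ineq v (max C₂ 10) ρ N k t Ψ
  rcases Nat.eq_zero_or_pos N with hN | hN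
  · subst hN
    exact ineq_N_zero v _ ρ k t Ψ hΨ
  · by_cases hsmall : (N : ℝ) ^ 8 * (ρ * (scatteringLength v).toReal ^ 3) ≤ c
    · -- few-body regime
      have hL : 0 < sideLength ρ N := sideLength_pos hρ hN
      obtain ⟨hE, hbr⟩ := hwin ρ hρ (lt_of_lt_of_le hρlt (min_le_left _ _)) N hN hsmall
      have hfew := fewBody_of_truncation hFB hT hv hL hE hk t Ψ hΨ
      have hbranch : max (ρ * (scatteringLength v).toReal) (psq (sideLength ρ N) k) = psq (sideLength ρ N) k :=
        max_eq_right (hbr k hk)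
      refine ineq_mono_const (C := 10) ?_ (le_max_right _ _)
      unfold Ineq
      rw [hbranch]
      linarith
    · -- many-body regime
      push Not at hsmall
      exact ineq_mono_const (hlarge ρ hρ (lt_of_lt_of_le hρlt (min_le_right _ _)) N hsmall k hk t Ψ hΨ)
        (le_max_left _ _)

/-- **Registered composition `staticResponseBound_of_fewBody`** (closed statement, hypotheses in the order
`FewBodyBounded`, `FewBodyWindow`, `TruncationLimit`, `LargeNHalf`): the crux BY NAME. [folklore] -/
theorem staticResponseBound_of_fewBody :
    (∀ w : ℝ → ℝ≥0∞, IsRepulsiveFiniteRange w → (∃ M : ℝ≥0∞, M ≠ ⊤ ∧ ∀ r, w r ≤ M) →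
      ∀ (N : ℕ) (L : ℝ), 0 < L →
        (N : ℝ) * (periodicGroundStateEnergy w N L).toReal * L ^ 2 ≤ 4 * Real.pi ^ 2 / 5 →
        ∀ (k : Fin 3 → ℤ), k ≠ 0 → ∀ (t : ℝ) (Ψ : PeriodicTrialState N L), periodicEnergy w Ψ ≠ ⊤ →
          (periodicGroundStateEnergy w N L).toReal - 10 * t ^ 2 * N / psq L k
            ≤ (periodicEnergy w Ψ).toReal + t * cosMean L k Ψ) →
    (∀ v : ℝ → ℝ≥0∞, IsRepulsiveFiniteRange v →
      ∃ ρ₀ : ℝ, 0 < ρ₀ ∧ ∃ c : ℝ, 0 < c ∧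
        ∀ ρ : ℝ, 0 < ρ → ρ < ρ₀ → ∀ N : ℕ, 1 ≤ N →
          (N : ℝ) ^ 8 * (ρ * (scatteringLength v).toReal ^ 3) ≤ c →
          (N : ℝ) * (periodicGroundStateEnergy v N (sideLength ρ N)).toReal * sideLength ρ N ^ 2
              ≤ 4 * Real.pi ^ 2 / 5 ∧
          ∀ k : Fin 3 → ℤ, k ≠ 0 → ρ * (scatteringLength v).toReal ≤ psq (sideLength ρ N) k) →
    (∀ v : ℝ → ℝ≥0∞, IsRepulsiveFiniteRange v → ∀ (N : ℕ) (L : ℝ), 0 < L →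
      periodicGroundStateEnergy v N L ≠ ⊤ →
      ∀ ε : ℝ, 0 < ε → ∃ n₁ : ℕ, ∀ n : ℕ, n₁ ≤ n →
        (periodicGroundStateEnergy v N L).toReal ≤
          (periodicGroundStateEnergy (truncPotential v n) N L).toReal + ε) →
    (∀ v : ℝ → ℝ≥0∞, IsRepulsiveFiniteRange v → ∀ c : ℝ, 0 < c →
      ∃ ρ₀ : ℝ, 0 < ρ₀ ∧ ∃ C : ℝ, 0 < C ∧
        ∀ ρ : ℝ, 0 < ρ → ρ < ρ₀ → ∀ N : ℕ,
          c < (N : ℝ) ^ 8 * (ρ * (scatteringLength v).toReal ^ 3) →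
          ∀ k : Fin 3 → ℤ, k ≠ 0 → ∀ t : ℝ, ∀ Ψ : PeriodicTrialState N (sideLength ρ N),
            periodicEnergy v Ψ ≠ ⊤ → Ineq v C ρ N k t Ψ) →
    StaticResponseBound :=
  fun hFB hW hT hG => staticResponseBound_of_fewBody' hFB hW hT hG

/-- **Calibration: the crux implies its many-body half** (drop the hypothesis). [folklore] -/
theorem largeNHalf_of_staticResponseBound (h : StaticResponseBound) :
    ∀ v : ℝ → ℝ≥0∞, IsRepulsiveFiniteRange v → ∀ c : ℝ, 0 < c →
      ∃ ρ₀ : ℝ, 0 < ρ₀ ∧ ∃ C : ℝ, 0 < C ∧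
        ∀ ρ : ℝ, 0 < ρ → ρ < ρ₀ → ∀ N : ℕ,
          c < (N : ℝ) ^ 8 * (ρ * (scatteringLength v).toReal ^ 3) →
          ∀ k : Fin 3 → ℤ, k ≠ 0 → ∀ t : ℝ, ∀ Ψ : PeriodicTrialState N (sideLength ρ N),
            periodicEnergy v Ψ ≠ ⊤ → Ineq v C ρ N k t Ψ := by
  intro v hv c _
  obtain ⟨ρ₀, hρ₀, C, hC, hbody⟩ := h v hv
  exact ⟨ρ₀, hρ₀, C, hC, fun ρ hρ hρlt N _ k hk t Ψ hΨ => hbody ρ hρ hρlt N k hk t Ψ hΨ⟩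

/-- **`StaticResponseBound ⟺ LargeNHalf`** given the few-body half, the few-body window and the truncation limit:
the crux is EXACTLY its thermodynamic (`N⁸ρa³ > c`) content. [folklore] -/
theorem staticResponseBound_iff_largeNHalf
    (hFB : ∀ w : ℝ → ℝ≥0∞, IsRepulsiveFiniteRange w → (∃ M : ℝ≥0∞, M ≠ ⊤ ∧ ∀ r, w r ≤ M) →
        ∀ (N : ℕ) (L : ℝ), 0 < L →
          (N : ℝ) * (periodicGroundStateEnergy w N L).toReal * L ^ 2 ≤ 4 * Real.pi ^ 2 / 5 →
          ∀ (k : Fin 3 → ℤ), k ≠ 0 → ∀ (t : ℝ) (Ψ : PeriodicTrialState N L), periodicEnergy w Ψ ≠ ⊤ →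
            (periodicGroundStateEnergy w N L).toReal - 10 * t ^ 2 * N / psq L k
              ≤ (periodicEnergy w Ψ).toReal + t * cosMean L k Ψ)
    (hW : ∀ v : ℝ → ℝ≥0∞, IsRepulsiveFiniteRange v →
        ∃ ρ₀ : ℝ, 0 < ρ₀ ∧ ∃ c : ℝ, 0 < c ∧
          ∀ ρ : ℝ, 0 < ρ → ρ < ρ₀ → ∀ N : ℕ, 1 ≤ N →
            (N : ℝ) ^ 8 * (ρ * (scatteringLength v).toReal ^ 3) ≤ c →
            (N : ℝ) * (periodicGroundStateEnergy v N (sideLength ρ N)).toReal * sideLength ρ N ^ 2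
                ≤ 4 * Real.pi ^ 2 / 5 ∧
            ∀ k : Fin 3 → ℤ, k ≠ 0 → ρ * (scatteringLength v).toReal ≤ psq (sideLength ρ N) k)
    (hT : ∀ v : ℝ → ℝ≥0∞, IsRepulsiveFiniteRange v → ∀ (N : ℕ) (L : ℝ), 0 < L →
        periodicGroundStateEnergy v N L ≠ ⊤ →
        ∀ ε : ℝ, 0 < ε → ∃ n₁ : ℕ, ∀ n : ℕ, n₁ ≤ n →
          (periodicGroundStateEnergy v N L).toReal ≤
            (periodicGroundStateEnergy (truncPotential v n) N L).toReal + ε) :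
    StaticResponseBound ↔
    ∀ v : ℝ → ℝ≥0∞, IsRepulsiveFiniteRange v → ∀ c : ℝ, 0 < c →
      ∃ ρ₀ : ℝ, 0 < ρ₀ ∧ ∃ C : ℝ, 0 < C ∧
        ∀ ρ : ℝ, 0 < ρ → ρ < ρ₀ → ∀ N : ℕ,
          c < (N : ℝ) ^ 8 * (ρ * (scatteringLength v).toReal ^ 3) →
          ∀ k : Fin 3 → ℤ, k ≠ 0 → ∀ t : ℝ, ∀ Ψ : PeriodicTrialState N (sideLength ρ N),
            periodicEnergy v Ψ ≠ ⊤ → Ineq v C ρ N k t Ψ :=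
  ⟨largeNHalf_of_staticResponseBound, staticResponseBound_of_fewBody' hFB hW hT⟩

end Summit.AtomisticToContinuum.BoseEinsteinCondensation.Cruxes.StaticResponseBound.FewBody

end
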